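import Summits.QuantumFields.YangMills.Theorems.UnitScaleTiltCoverLettersDcsE
import Summits.QuantumFields.YangMills.Theorems.UnitScaleTiltCoverFlatHKey
import Summits.QuantumFields.YangMills.Theorems.UnitScaleTiltCoverSitesPush
import Summits.QuantumFields.YangMills.Theorems.UnitScaleTiltProp8FlatPortColumnLetterL0
import Summits.QuantumFields.YangMills.Theorems.UnitScaleTiltProp8FlatPortCurlCurlPairingL0
import HarnessLib

/-!
# Route `UnitScaleTilt`, crux K1 «MinimiserStabilityRegPr» (stmt-QuantumFields-19200), leaf `stub_halvingStep` — the (P2-small) branch by COVERING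
# (★★OWNER RULING g26-№18 (α) ∕ ACK 36, brick α6b): **THE COLUMN INPUTS (X2-H) AND THE `∂*∂` PAIRING ROW (X2-CH) OF THE V1L0 PORT WITHOUT THE TORUS-SIZE FLOOR**

Cell `ym3-torus` (HUMAN RULING D-0037, YM ladder rung R3 — continuum SU(2) YM₃ on the torus is a RUNG, not the Clay problem), explicit-unit helper seat `ym-ust-19200-w4` gen 3,
row α6b of ACK 36 (★w7-19200 g0 holds α6a = (P-1)∕(P-2)∕(P-3)).  Def-light (one def: the canonical lift `valLift`); `--supports stmt-QuantumFields-19200 --as helper`.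

THE POINT (LEAD's plan `H-SMALL-PLAN-w5g3.md` §3, ★w7-19200 g0's port census 08:42Z).  Two of the six P2-side ports that thread `hsize : a′ + 3 ≤ m + n` (✓`FlatPortKernelRows.chart_params`):
(P-4) ✓`FlatPortColumnLetterL0.columnInputs_of_adm22` (the (X2-H) column kernel majorant `ks` with its transposed column sum `≤ K₀η⁻³`) and (P-5)
✓`FlatPortCurlCurlPairingL0.curlCurlPairing_of_adm22` (the (X2-CH) pairing row `|Σ_b (∂*∂HX)(b)Z(b)| ≤ CP·η⁻³·s·Σ|X|`).  A member below the floor is read on its `L^{jc}`-fold cover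
(`jc := a′₀ + 3 − m − n` after the `a′`-REDUCTION `Mh = L^{a′} ↦ L^{a′₀}`, `R ↦ R·L^{a′−a′₀}`, which keeps `Adm22` — `adm22_reduce`), where the port applies, and the conclusions DESCEND
through the key lemma of the branch (α4, ✓`CoverFlatH.flatH_cover`: `flatH̃ (X ∘ π_I) b̃ = flatH X (π b̃)`; the transfer lemmas §1–§2 take it as `hkey`):
* §1 (P-5), «shape (b)»: `Z̃ := Z ∘ π`, `X̃ := X ∘ π_I`; `Σ_{b̃}(∂̃*∂̃H̃X̃)(b̃)Z(π b̃) = (L^{jc})³·Σ_b(∂*∂HX)(b)Z(b)` (`hkey` ∘ ✓`dcsE_dcE_cover` ∘ ✓`pushBond_comp_projBond`) and `Σ_{c̃}|X(π_I c̃)| = (L^{jc})³·Σ_c|X c|`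
  (✓`card_fibre_idx`) ⇒ `pairing_of_cover`: the SAME `CP` downstairs.
* §2 (P-4): `ks x c := Σ_{c̃ ∈ fibre c} k̃s (valLift x) c̃` with the CANONICAL lift `valLift x := (x_μ.val)_μ` — blocks of EVERY level lift to blocks (`val_iterBlockOf` up and down), so the
  block-constancy clause descends; `e_c ∘ π_I = Σ_{fibre} e_{c̃}` + `hkey` give the kernel bound; the downstairs column is a sub-column of the upstairs one (`b ↦ ⟨valLift b₋, dir⟩` is
  injective, all terms `≥ 0`) times the fibre count ⇒ `columnInputs_of_cover`: `K₀ ↦ K₀·(L^{jc})³`.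
* §3 ★★★ `curlCurlPairing_of_adm22_allSizes`, ★★★ `columnInputs_of_adm22_allSizes`: the port statements VERBATIM with `(_ : a′ + 3 ≤ m + n)` DELETED (threshold `Mh₀ ↦ L^{Mh₀}`,
  `R₀` unchanged, `CP` unchanged, `K₀ ↦ K₀·(L^{Mh₀+2})³` inside the `∃`), UNCONDITIONAL: the key lemma is ✓`CoverFlatH.flatH_cover` (★w1-20520 g5's `…CoverFlatHKey` on LEAD's
  `…CoverDeltaA`∕`…CoverAveragesRange`).
HONEST SCOPE: finite sums, `ZMod.val` arithmetic, linearity of `flatH`; nothing of print is asserted; NOT a claim about the stub, the crux or the gap.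

References: T. Bałaban, CMP **96** (1984) 223–250 [Balaban1984PropagatorsII] ((2.1)–(2.4) p.224, Cor. 2.8 (2.150)–(2.151) p.249 — volume-uniform estimates); CMP **102** (1985)
277–309 [Balaban1985Variational] ((46) p.285, (88)–(90) pp.291–292, (161)–(163) p.303); CMP **95** (1984) 17–40 [Balaban1984PropagatorsI] ((1.6) p.18 — cubes by integer division).
-/

open scoped BigOperators

noncomputable section

namespace Summit.QuantumFields.YangMills.Theorems.FlatPortAllSizesCol

open Literature.MathematicalPhysics.QuantumFieldTheory.Balaban1983to89
open B6SectADomainsV1 (Domains)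
open B6SectAOperatorsV1 (BondIdx SiteIdx dcE dcsE)
open B5Eq118OneStroke (iterBlockOf val_iterBlockOf)
open B6GlobalChartV1 (PV)
open T3ContinuumYM3Torus (T3Family)
open FlatCubeOpsText (Adm22 distBI IsLevWeight)
open FlatOpsLettersAssembly (flatH)
open CoverSites (cover proj projBond projBond_src projBond_dir proj_natCast sitesPerDir_le card_fibre_bond pushBond pushBond_comp_projBond
  sum_cover_bond_eq_sum_pushBond)
open CoverDomains (projIdx projIdx_level projIdx_surjective card_fibre_idx sum_idx_cover_eq_sum_fibre le_sum_fibre_of_nonneg lamSite_comap_iff adm22_comap isLevWeight_comap)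
open CoverLetters (fibreIdx mem_fibreIdx fibreIdx_nonempty proj_shift_T3 projBond_mk_T3 cover_L_real dcsE_dcE_cover)

/-! ## §0 Tools: the canonical lift of fine sites, fibre sums of periodic data -/

section Tools

variable {P : Params} (jc : ℕ)

/-- **THE CANONICAL LIFT** of a fine site: the same integer labels, read modulo the cover's period. [cite: Balaban1984PropagatorsI, (1.6) p.18] -/
def valLift (x : Site P 0) : Site (cover P jc) 0 := fun μ => (((x μ).val : ℕ) : ZMod ((cover P jc).sitesPerDir 0))

/-- `π (valLift x) = x`. [cite: Balaban1984PropagatorsI, (1.6) p.18] -/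
theorem proj_valLift (x : Site P 0) : proj P jc 0 (valLift jc x) = x := by
  unfold valLift
  rw [proj_natCast]
  funext μ
  exact ZMod.natCast_zmod_val (x μ)

/-- the lift keeps the labels. [cite: Balaban1984PropagatorsI, (1.6) p.18] -/
theorem val_valLift (x : Site P 0) (μ : Fin P.d) : (valLift jc x μ).val = (x μ).val := by
  unfold valLift
  exact ZMod.val_cast_of_lt ((ZMod.val_lt _).trans_le (sitesPerDir_le P jc 0))

/-- **BLOCKS OF EVERY LEVEL LIFT TO BLOCKS**: two fine sites in the same `j`-block (`j ≤ m + K`) have canonical lifts in the same `j`-block of the cover (the `j`-block of a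
site is its label integer-divided by `L^j`, ✓`val_iterBlockOf`, and the lift keeps labels). [cite: Balaban1984PropagatorsI, (1.6) p.18] -/
theorem iterBlockOf_valLift_eq {j : ℕ} (hj : j ≤ P.m + P.K) {x x' : Site P 0} (h : iterBlockOf j x = iterBlockOf j x') :
    iterBlockOf j (valLift jc x) = iterBlockOf j (valLift jc x') := by
  have hj' : j ≤ (cover P jc).m + (cover P jc).K := by show j ≤ P.m + jc + P.K; omega
  funext μ
  apply ZMod.val_injective
  rw [val_iterBlockOf j hj' _ μ, val_iterBlockOf j hj' _ μ, val_valLift, val_valLift]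
  have := congrArg (fun y : Site P j => (y μ).val) h
  simpa only [val_iterBlockOf j hj] using this

/-- the `j`-block of a canonical lift projects to the `j`-block downstairs. [cite: Balaban1987RG1, (0.3) p.252] -/
theorem proj_iterBlockOf_valLift {j : ℕ} (hj : j ≤ P.m + P.K) (x : Site P 0) : proj P jc j (iterBlockOf j (valLift jc x)) = iterBlockOf j x := by
  rw [CoverSites.proj_iterBlockOf P jc j hj, proj_valLift]

/-- the canonical lift of a bond: lift the source, keep the direction. [cite: Balaban1984PropagatorsII, (2.3) p.224] -/
def valLiftBond (b : PBond P 0) : PBond (cover P jc) 0 := ⟨valLift jc b.src, b.dir⟩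

/-- `π (valLiftBond b) = b`. [cite: Balaban1984PropagatorsII, (2.3) p.224] -/
theorem projBond_valLiftBond (b : PBond P 0) : projBond P jc 0 (valLiftBond jc b) = b := by
  cases b with
  | mk x μ => simp only [valLiftBond, projBond, proj_valLift]

/-- `valLiftBond` is injective. [folklore] -/
theorem valLiftBond_injective : Function.Injective (valLiftBond (P := P) jc) := fun b b' h => by
  have := congrArg (projBond P jc 0) h
  rwa [projBond_valLiftBond, projBond_valLiftBond] at this

variable (D : Domains P)

/-- **FIBRE SUMS OF PERIODIC INDEX DATA**: `Σ_{c̃} f(π_I c̃) = (L^{jc})^d · Σ_c f c`. [cite: Balaban1984PropagatorsII, (2.3) p.224] -/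
theorem sum_comp_projIdx [DecidableEq (BondIdx D)] (f : BondIdx D → ℝ) : ∑ ct, f (projIdx D jc ct) = ((P.L ^ jc) ^ P.d : ℕ) * ∑ c, f c := by
  rw [sum_idx_cover_eq_sum_fibre D jc, Finset.mul_sum]
  refine Finset.sum_congr rfl fun c _ => ?_
  rw [Finset.sum_congr rfl fun ct hct => by rw [(Finset.mem_filter.1 hct).2], Finset.sum_const, card_fibre_idx D jc c, nsmul_eq_mul]

/-- **FIBRE SUMS OF PERIODIC BOND DATA**: `Σ_{b̃} g(π b̃) = (L^{jc})^d · Σ_b g b`. [cite: Balaban1984PropagatorsII, (2.8) p.224] -/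
theorem sum_comp_projBond (g : PBond P 0 → ℝ) : ∑ bt, g (projBond P jc 0 bt) = ((P.L ^ jc) ^ P.d : ℕ) * ∑ b, g b := by
  classical
  rw [sum_cover_bond_eq_sum_pushBond P jc 0, Finset.mul_sum]
  refine Finset.sum_congr rfl fun b _ => ?_
  rw [pushBond_comp_projBond P jc 0 (Nat.zero_le _) g b, nsmul_eq_mul]

/-- **THE INDICATOR OF AN INDEX BOND, PULLED BACK, IS THE SUM OF THE INDICATORS OF ITS FIBRE**: `e_c ∘ π_I = Σ_{c̃ ∈ π_I⁻¹c} e_{c̃}`. [cite: Balaban1984PropagatorsII, (2.3) p.224] -/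
theorem single_comp_projIdx [DecidableEq (BondIdx D)] [DecidableEq (BondIdx (D.comap jc))] (c : BondIdx D) :
    (fun ct => (Pi.single c (1 : ℝ) : BondIdx D → ℝ) (projIdx D jc ct)) = ∑ ct ∈ fibreIdx D jc c, (Pi.single ct (1 : ℝ) : BondIdx (D.comap jc) → ℝ) := by
  funext ct
  rw [Finset.sum_apply, Pi.single_apply]
  by_cases h : projIdx D jc ct = c
  · rw [if_pos h, Finset.sum_eq_single_of_mem ct ((mem_fibreIdx D jc).2 h) fun ct' _ hne => Pi.single_eq_of_ne' hne _, Pi.single_eq_same]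
  · rw [if_neg h]
    symm
    exact Finset.sum_eq_zero fun ct' hct' => Pi.single_eq_of_ne (fun hh : ct = ct' => h (by rw [hh]; exact (mem_fibreIdx D jc).1 hct')) _

/-- the same with `∘`. [cite: Balaban1984PropagatorsII, (2.3) p.224] -/
theorem single_comp_projIdx' [DecidableEq (BondIdx D)] [DecidableEq (BondIdx (D.comap jc))] (c : BondIdx D) :
    (Pi.single c (1 : ℝ) : BondIdx D → ℝ) ∘ projIdx D jc = ∑ ct ∈ fibreIdx D jc c, (Pi.single ct (1 : ℝ) : BondIdx (D.comap jc) → ℝ) :=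
  single_comp_projIdx jc D c

end Tools

/-! ## §1 (P-5) The `∂*∂` pairing row descends with the SAME constant -/

section Transfer

variable (F : T3Family) (n K jc : ℕ) (D : Domains (F.P K))

/-- positivity of the deck cardinality `(L^{jc})^3`. [folklore] -/
theorem deck_pos : (0 : ℝ) < (((F.P K).L ^ jc) ^ (F.P K).d : ℕ) := by
  have hL : 1 ≤ (F.P K).L := by have := (F.P K).hL.2; omega
  exact_mod_cast Nat.pos_iff_ne_zero.2 (pow_ne_zero _ (pow_ne_zero _ (by omega)))

/-- ★★ **(X2-CH) DESCENDS, SAME `CP`** («shape (b)»): if the pairing row holds on the cover for the periodic data `Z ∘ π`, `X ∘ π_I`, then it holds downstairs with the same constant —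
the upstairs left side is `(L^{jc})³` times the downstairs one (`hkey` ∘ ✓`dcsE_dcE_cover` ∘ fibre count on bonds) and so is the upstairs right side (fibre count on index bonds).
[cite: Balaban1985Variational, (88)–(90) pp.291–292, (161) p.303; Balaban1984PropagatorsII, (2.19) p.226, Cor. 2.8 p.249] -/
theorem pairing_of_cover [DecidableEq (BondIdx D)] {CP E s : ℝ}
    (hkey : ∀ (X : BondIdx D → ℝ) (bt : PBond ((F.cover jc).P K) 0),
      flatH (F.cover jc) n K (D.comap jc) (X ∘ projIdx D jc) bt = flatH F n K D X (projBond (F.P K) jc 0 bt))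
    (Z : PBond (F.P K) 0 → ℝ) (X : BondIdx D → ℝ)
    (hup : |∑ bt : PBond ((F.cover jc).P K) 0,
        (dcsE ((F.L : ℝ) ^ (K - n)) (dcE ((F.L : ℝ) ^ (K - n)) (WithLp.toLp 2 (flatH (F.cover jc) n K (D.comap jc) (X ∘ projIdx D jc))))) bt *
          Z (projBond (F.P K) jc 0 bt)| ≤ CP * E * s * ∑ ct, |(X ∘ projIdx D jc) ct|) :
    |∑ b : PBond (F.P K) 0, (dcsE ((F.L : ℝ) ^ (K - n)) (dcE ((F.L : ℝ) ^ (K - n)) (WithLp.toLp 2 (flatH F n K D X)))) b * Z b| ≤ CP * E * s * ∑ c, |X c| := by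
  set T : PBond (F.P K) 0 → ℝ := fun b => (dcsE ((F.L : ℝ) ^ (K - n)) (dcE ((F.L : ℝ) ^ (K - n)) (WithLp.toLp 2 (flatH F n K D X)))) b with hT
  set N : ℝ := ((((F.P K).L ^ jc) ^ (F.P K).d : ℕ) : ℝ) with hN
  have hN0 : 0 < N := deck_pos F K jc
  -- the upstairs left side is `N` times the downstairs one
  have hA : ∀ bt : PBond ((F.cover jc).P K) 0,
      (dcsE ((F.L : ℝ) ^ (K - n)) (dcE ((F.L : ℝ) ^ (K - n)) (WithLp.toLp 2 (flatH (F.cover jc) n K (D.comap jc) (X ∘ projIdx D jc))))) bt * Z (projBond (F.P K) jc 0 bt) =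
        (fun b => T b * Z b) (projBond (F.P K) jc 0 bt) := fun bt => by
    rw [dcsE_dcE_cover F n K jc (flatH F n K D X) (flatH (F.cover jc) n K (D.comap jc) (X ∘ projIdx D jc)) (hkey X) bt]
  have hB : ∑ bt : PBond ((F.cover jc).P K) 0,
      (dcsE ((F.L : ℝ) ^ (K - n)) (dcE ((F.L : ℝ) ^ (K - n)) (WithLp.toLp 2 (flatH (F.cover jc) n K (D.comap jc) (X ∘ projIdx D jc))))) bt * Z (projBond (F.P K) jc 0 bt) =
        N * ∑ b, T b * Z b := by
    rw [Finset.sum_congr rfl fun bt _ => hA bt]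
    exact sum_comp_projBond jc (fun b => T b * Z b)
  -- the upstairs right side is `N` times the downstairs one
  have hC : ∑ ct, |(X ∘ projIdx D jc) ct| = N * ∑ c, |X c| := sum_comp_projIdx jc D (fun c => |X c|)
  rw [hB, hC, abs_mul, abs_of_pos hN0] at hup
  have h1 : N * |∑ b, T b * Z b| ≤ N * (CP * E * s * ∑ c, |X c|) := hup.trans (le_of_eq (by ring))
  exact le_of_mul_le_mul_left h1 hN0

/-! ## §2 (P-4) The column kernel majorant descends with `K₀ ↦ K₀·(L^{jc})³` -/

/-- ★★ **(X2-H) COLUMN INPUTS DESCEND**: from a kernel majorant `k̃s` of the columns of `H̃` (any linear `H̃` on the cover with `H̃ (X ∘ π_I) = (flatH X) ∘ π` — the key lemma; stated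
for an ABSTRACT `Ht` so that the cover's two spellings `(F.cover jc).P K = cover (F.P K) jc` never meet inside one rewrite) on the cover (nonnegative, constant on the blocks of every site index of `D̃`, transposed column
sum `≤ K₀·E` for the lifted weights), the majorant `ks x c := Σ_{c̃ ∈ π_I⁻¹c} k̃s (valLift x) c̃` of the columns of `flatH` downstairs — nonnegative, block-constant, column sum `≤ K₀·(L^{jc})³·E`.
[cite: Balaban1984PropagatorsII, (2.1)–(2.4) p.224, Cor. 2.8 (2.150)–(2.151) p.249; Balaban1985Variational, (46) p.285, (161)–(163) p.303] -/
theorem columnInputs_of_cover [DecidableEq (BondIdx D)] [DecidableEq (BondIdx (D.comap jc))] {K₀ E : ℝ} {w : ℕ → PBond (F.P K) 0 → ℝ}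
    (hw : IsLevWeight F n K D w) (Ht : (BondIdx (D.comap jc) → ℝ) →ₗ[ℝ] (PBond (cover (F.P K) jc) 0 → ℝ))
    (hkey : ∀ (X : BondIdx D → ℝ) (bt : PBond (cover (F.P K) jc) 0), Ht (X ∘ projIdx D jc) bt = flatH F n K D X (projBond (F.P K) jc 0 bt))
    (kst : Site (cover (F.P K) jc) 0 → BondIdx (D.comap jc) → ℝ) (hks0 : ∀ xt ct, 0 ≤ kst xt ct)
    (hK : ∀ (ct : BondIdx (D.comap jc)) (bt : PBond (cover (F.P K) jc) 0), |Ht (Pi.single ct 1) bt| ≤ kst bt.src ct)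
    (hblk : ∀ (ct : BondIdx (D.comap jc)) (st : SiteIdx (D.comap jc)) (xt xt' : Site (cover (F.P K) jc) 0),
      iterBlockOf (st.1.1 : ℕ) xt = st.1.2 → iterBlockOf (st.1.1 : ℕ) xt' = st.1.2 → kst xt ct = kst xt' ct)
    (hcol : ∀ ct : BondIdx (D.comap jc), ∑ bt : PBond (cover (F.P K) jc) 0, (w 3 (projBond (F.P K) jc 0 bt))⁻¹ * kst bt.src ct ≤ K₀ * E) :
    ∃ ks : Site (F.P K) 0 → BondIdx D → ℝ,
      (∀ x c, 0 ≤ ks x c) ∧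
      (∀ (c : BondIdx D) (b : PBond (F.P K) 0), |flatH F n K D (Pi.single c 1) b| ≤ ks b.src c) ∧
      (∀ (c : BondIdx D) (s : SiteIdx D) (x x' : Site (F.P K) 0), iterBlockOf (s.1.1 : ℕ) x = s.1.2 → iterBlockOf (s.1.1 : ℕ) x' = s.1.2 → ks x c = ks x' c) ∧
      ∀ c : BondIdx D, ∑ b : PBond (F.P K) 0, (w 3 b)⁻¹ * ks b.src c ≤ K₀ * ((((F.P K).L ^ jc) ^ (F.P K).d : ℕ) : ℝ) * E := by
  refine ⟨fun x c => ∑ ct ∈ fibreIdx D jc c, kst (valLift jc x) ct, fun x c => Finset.sum_nonneg fun ct _ => hks0 _ _, fun c b => ?_, fun c s x x' hx hx' => ?_, fun c => ?_⟩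
  · -- the kernel bound: `flatH e_c b = flatH̃ (e_c ∘ π_I) b̃ = Σ_{fibre} flatH̃ e_{c̃} b̃` at the canonical lift `b̃`
    have hb : projBond (F.P K) jc 0 (valLiftBond jc b) = b := projBond_valLiftBond jc b
    have h1 : flatH F n K D (Pi.single c 1) b = ∑ ct ∈ fibreIdx D jc c, Ht (Pi.single ct 1) (valLiftBond jc b) := by
      have e1 := hkey (Pi.single c 1) (valLiftBond jc b)
      rw [hb] at e1
      rw [← e1, single_comp_projIdx' jc D c, map_sum, Finset.sum_apply]
    rw [h1]
    exact (Finset.abs_sum_le_sum_abs _ _).trans (Finset.sum_le_sum fun ct _ => hK ct (valLiftBond jc b))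
  · -- block constancy: the canonical lifts of `x`, `x′` lie in the same block of the lifted site index
    have hj : (s.1.1 : ℕ) ≤ (F.P K).m + (F.P K).K := le_trans (Nat.lt_succ_iff.1 s.1.1.isLt) D.hk
    have hxx' : iterBlockOf (s.1.1 : ℕ) x = iterBlockOf (s.1.1 : ℕ) x' := by rw [hx, hx']
    set st : SiteIdx (D.comap jc) := ⟨⟨s.1.1, iterBlockOf (s.1.1 : ℕ) (valLift jc x)⟩,
      (lamSite_comap_iff D jc _ _).2 (by rw [proj_iterBlockOf_valLift jc hj, hx]; exact s.2)⟩ with hst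
    exact Finset.sum_congr rfl fun ct _ => hblk ct st (valLift jc x) (valLift jc x') rfl (iterBlockOf_valLift_eq jc hj hxx').symm
  · -- the column sum: a sub-column of each upstairs column of the fibre, times the fibre count
    have hw0 : ∀ b : PBond (F.P K) 0, 0 ≤ (w 3 b)⁻¹ := fun b => inv_nonneg.2 (FlatOpsLettersAssembly.levWeight_nonneg hw 3 b)
    have hsub : ∀ ct : BondIdx (D.comap jc), ∑ b : PBond (F.P K) 0, (w 3 b)⁻¹ * kst (valLift jc b.src) ct ≤ K₀ * E := fun ct => by
      classical
      have hg0 : ∀ bt : PBond (cover (F.P K) jc) 0, 0 ≤ (w 3 (projBond (F.P K) jc 0 bt))⁻¹ * kst bt.src ct := fun bt => mul_nonneg (hw0 _) (hks0 _ _)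
      calc ∑ b : PBond (F.P K) 0, (w 3 b)⁻¹ * kst (valLift jc b.src) ct
          = ∑ b : PBond (F.P K) 0, (fun bt : PBond (cover (F.P K) jc) 0 => (w 3 (projBond (F.P K) jc 0 bt))⁻¹ * kst bt.src ct) (valLiftBond jc b) :=
            Finset.sum_congr rfl fun b _ => by simp only [projBond_valLiftBond]; rfl
        _ = ∑ bt ∈ Finset.univ.image (valLiftBond (P := F.P K) jc), (w 3 (projBond (F.P K) jc 0 bt))⁻¹ * kst bt.src ct :=
            (Finset.sum_image (s := Finset.univ) (g := valLiftBond (P := F.P K) jc)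
              (f := fun bt : PBond (cover (F.P K) jc) 0 => (w 3 (projBond (F.P K) jc 0 bt))⁻¹ * kst bt.src ct)
              fun b _ b' _ h => valLiftBond_injective jc h).symm
        _ ≤ ∑ bt, (w 3 (projBond (F.P K) jc 0 bt))⁻¹ * kst bt.src ct :=
            Finset.sum_le_sum_of_subset_of_nonneg (Finset.subset_univ _) fun bt _ _ => hg0 bt
        _ ≤ K₀ * E := hcol ct
    calc ∑ b : PBond (F.P K) 0, (w 3 b)⁻¹ * ∑ ct ∈ fibreIdx D jc c, kst (valLift jc b.src) ct
        = ∑ ct ∈ fibreIdx D jc c, ∑ b : PBond (F.P K) 0, (w 3 b)⁻¹ * kst (valLift jc b.src) ct := by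
          rw [Finset.sum_comm]; exact Finset.sum_congr rfl fun b _ => Finset.mul_sum _ _ _
      _ ≤ ∑ ct ∈ fibreIdx D jc c, K₀ * E := Finset.sum_le_sum fun ct _ => hsub ct
      _ = K₀ * ((((F.P K).L ^ jc) ^ (F.P K).d : ℕ) : ℝ) * E := by
          rw [Finset.sum_const, nsmul_eq_mul]
          unfold fibreIdx
          rw [card_fibre_idx D jc c]
          ring

end Transfer

/-! ## §3 ★★★ The two port statements without the torus-size floor -/

section AllSizes

/-- `1 ≤ 2 + 1` (the `PV 2 …` dimension side condition, as in the port files). [folklore] -/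
private theorem hd3 : 1 ≤ 2 + 1 := by norm_num

/-- **THE `a′`-REDUCTION**: admissibility for the big blocks `L·L^{a′}` with separation `R` gives admissibility for the FINER big blocks `L·L^{a₀}`, `a₀ ≤ a′`, with separation
`R·L^{a′−a₀}` (membership constant on coarse blocks is constant on fine ones; the separation product is unchanged). [cite: Balaban1984PropagatorsII, (2.1)–(2.2) p.224] -/
theorem adm22_reduce {P : Params} (D : Domains P) {R a' a₀ : ℕ} (ha : a₀ ≤ a') (h : Adm22 D R (P.L * P.L ^ a')) :
    Adm22 D (R * P.L ^ (a' - a₀)) (P.L * P.L ^ a₀) := by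
  have hM : P.L * P.L ^ a' = (P.L * P.L ^ a₀) * P.L ^ (a' - a₀) := by
    rw [mul_assoc, ← pow_add, Nat.add_sub_cancel' ha]
  obtain ⟨h1, h2⟩ := h
  refine ⟨fun j hj y y' hyy' => h1 j hj y y' fun μ => ?_, fun j y y' hy hy' => ?_⟩
  · rw [hM, ← Nat.div_div_eq_div_mul ((y μ).val) (P.L * P.L ^ a₀) (P.L ^ (a' - a₀)),
      ← Nat.div_div_eq_div_mul ((y' μ).val) (P.L * P.L ^ a₀) (P.L ^ (a' - a₀)), hyy' μ]
  · have hRM : R * P.L ^ (a' - a₀) * (P.L * P.L ^ a₀) = R * (P.L * P.L ^ a') := by rw [hM]; ring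
    rw [hRM]
    exact h2 j y y' hy hy'

/-- `a₀ ≤ a′` from `L^{a₀} ≤ L^{a′}` (`L ≥ 2`). [folklore] -/
theorem le_of_pow_le_pow {L a₀ a' : ℕ} (hL : 2 ≤ L) (h : L ^ a₀ ≤ L ^ a') : a₀ ≤ a' :=
  (Nat.pow_le_pow_iff_right hL).1 h

/-- the gradient hypothesis of (X2-CH) lifts to the cover for `Z ∘ π` (shifts commute with `π`). [cite: Balaban1987RG1, (0.1) p.251] -/
theorem gradHyp_lift {P : Params} (jc : ℕ) {w : ℕ → PBond P 0 → ℝ} {Z : PBond P 0 → ℝ} {c s : ℝ}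
    (hZ : ∀ (b : PBond P 0) (ν : Fin P.d), w 2 b * c * |Z ⟨b.src.shift ν, b.dir⟩ - Z b| ≤ s) (bt : PBond (cover P jc) 0) (ν : Fin P.d) :
    w 2 (projBond P jc 0 bt) * c * |Z (projBond P jc 0 ⟨bt.src.shift ν, bt.dir⟩) - Z (projBond P jc 0 bt)| ≤ s := by
  have h := hZ (projBond P jc 0 bt) ν
  have e : projBond P jc 0 ⟨bt.src.shift ν, bt.dir⟩ = ⟨(projBond P jc 0 bt).src.shift ν, (projBond P jc 0 bt).dir⟩ := by
    simp only [projBond, CoverSites.proj_shift]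
  rw [e]
  exact h

/-- ★★★ **(P-5) WITHOUT THE TORUS-SIZE FLOOR**: ✓`FlatPortCurlCurlPairingL0.curlCurlPairing_of_adm22` with the binder `a′ + 3 ≤ m + n` DELETED and the SAME `CP`
(threshold `Mh₀ ↦ L^{Mh₀}`, `R₀` unchanged): a member above the floor (after the `a′`-reduction) is the port's; a member below it is read on its `L^{jc}`-fold cover,
`jc = Mh₀ + 3 − m − n`, through `pairing_of_cover` and the key lemma of the branch ✓`CoverFlatH.flatH_cover` (★w1-20520 g5 ∕ LEAD, unconditional).
[cite: Balaban1985Variational, (88)–(90) pp.291–292, (161) p.303; Balaban1984PropagatorsII, (2.19) p.226, Cor. 2.8 (2.150)–(2.151) p.249] -/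
theorem curlCurlPairing_of_adm22_allSizes (ℓ : ℕ) (hL : Odd (ℓ + 1) ∧ 1 < ℓ + 1) (hℓ : 4 ≤ ℓ) :
    ∃ (Mh₀ R₀ : ℕ) (CP : ℝ), 0 ≤ CP ∧
    ∀ (m : ℕ) (hm : 1 ≤ m) (n K : ℕ) (_ : 1 ≤ K - n) (_ : K - n + 1 ≤ m + K) {Mh R a' : ℕ} (_ : Mh = (ℓ + 1) ^ a') (_ : Mh₀ ≤ Mh) (_ : R₀ ≤ R)
      (D : Domains (PV 2 ℓ m K hd3 hL)) (_ : D.k = K - n) (_ : Adm22 D R ((ℓ + 1) * Mh))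
      (w : ℕ → PBond (PV 2 ℓ m K hd3 hL) 0 → ℝ) (_ : IsLevWeight (⟨ℓ + 1, hL, m, hm⟩ : T3Family) n K D w)
      (Z : PBond (PV 2 ℓ m K hd3 hL) 0 → ℝ) (s : ℝ) (_ : 0 ≤ s)
      (_ : ∀ (b : PBond (PV 2 ℓ m K hd3 hL) 0) (ν : Fin (2 + 1)), w 2 b * (((ℓ + 1 : ℕ) : ℝ)) ^ (K - n) * |Z ⟨b.src.shift ν, b.dir⟩ - Z b| ≤ s)
      (X : BondIdx D → ℝ),
        |∑ b : PBond (PV 2 ℓ m K hd3 hL) 0, (dcsE ((((ℓ + 1 : ℕ) : ℝ)) ^ (K - n)) (dcE ((((ℓ + 1 : ℕ) : ℝ)) ^ (K - n))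
            (WithLp.toLp 2 (flatH (⟨ℓ + 1, hL, m, hm⟩ : T3Family) n K D X)))) b * Z b| ≤
          CP * ((((ℓ + 1 : ℕ) : ℝ)) ^ (K - n)) ^ 3 * s * ∑ c, |X c| := by
  obtain ⟨Mh₀, R₀, CP, hCP, hmain⟩ := FlatPortCurlCurlPairingL0.curlCurlPairing_of_adm22 ℓ hL hℓ
  have hL2 : 2 ≤ ℓ + 1 := by omega
  refine ⟨(ℓ + 1) ^ Mh₀, R₀, CP, hCP, ?_⟩
  intro m hm n K hk1 hk' Mh R a' hMha hMh hR D hDk hAdm w hw Z s hs hZ X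
  -- the `a′`-reduction to `a₀ := Mh₀`
  have ha : Mh₀ ≤ a' := le_of_pow_le_pow hL2 (by rw [← hMha]; exact hMh)
  have hMh₀ : Mh₀ ≤ (ℓ + 1) ^ Mh₀ := (Nat.lt_pow_self (by omega)).le
  have hR' : R₀ ≤ R * (ℓ + 1) ^ (a' - Mh₀) := hR.trans (Nat.le_mul_of_pos_right _ (pow_pos (by omega) _))
  rw [hMha] at hAdm
  have hAdm' : Adm22 D (R * (ℓ + 1) ^ (a' - Mh₀)) ((ℓ + 1) * (ℓ + 1) ^ Mh₀) := adm22_reduce D ha hAdm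
  by_cases hsz : Mh₀ + 3 ≤ m + n
  · -- above the floor: the port itself
    exact hmain m hm n K hk1 hk' rfl hMh₀ hR' hsz D hDk hAdm' w hw Z s hs hZ X
  · -- below the floor: read on the `L^{jc}`-fold cover
    set jc : ℕ := Mh₀ + 3 - (m + n) with hjc
    have hsz' : Mh₀ + 3 ≤ (m + jc) + n := by omega
    have hup := hmain (m + jc) (by omega) n K hk1 (by omega) rfl hMh₀ hR' hsz' (D.comap jc) hDk
      (adm22_comap D jc ⟨Mh₀ + 1, by ring⟩ hAdm') (fun i bt => w i (projBond (PV 2 ℓ m K hd3 hL) jc 0 bt))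
      (isLevWeight_comap (⟨ℓ + 1, hL, m, hm⟩ : T3Family) n K jc D hw)
      (fun bt => Z (projBond (PV 2 ℓ m K hd3 hL) jc 0 bt)) s hs (fun bt ν => gradHyp_lift jc hZ bt ν) (X ∘ projIdx D jc)
    exact pairing_of_cover (⟨ℓ + 1, hL, m, hm⟩ : T3Family) n K jc D
      (fun X bt => CoverFlatH.flatH_cover (⟨ℓ + 1, hL, m, hm⟩ : T3Family) n K jc D X bt) Z X hup

/-- ★★★ **(P-4) WITHOUT THE TORUS-SIZE FLOOR**: ✓`FlatPortColumnLetterL0.columnInputs_of_adm22` with the binder `a′ + 3 ≤ m + n` DELETED (threshold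
`Mh₀ ↦ L^{Mh₀}`, `R₀` unchanged, `K₀ ↦ K₀·(L^{Mh₀+2})³` — the deck factor of the cover, `jc ≤ Mh₀ + 2`; the displayed shape of the column bound is VERBATIM the port's): above the floor the port's majorant (its column bound weakened to the larger
constant); below it the descended majorant of `columnInputs_of_cover` on the `L^{jc}`-fold cover, key lemma ✓`CoverFlatH.flatH_cover`.
[cite: Balaban1984PropagatorsII, (2.1)–(2.4) p.224, Cor. 2.8 (2.150)–(2.151) p.249; Balaban1985Variational, (46) p.285, (161)–(163) p.303] -/
theorem columnInputs_of_adm22_allSizes (ℓ : ℕ) (hL : Odd (ℓ + 1) ∧ 1 < ℓ + 1) (hℓ : 4 ≤ ℓ) :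
    ∃ (Mh₀ R₀ : ℕ) (K₀ : ℝ), 0 ≤ K₀ ∧
    ∀ (m : ℕ) (hm : 1 ≤ m) (n K : ℕ) (_ : 1 ≤ K - n) (_ : K - n + 1 ≤ m + K) {Mh R a' : ℕ} (_ : Mh = (ℓ + 1) ^ a') (_ : Mh₀ ≤ Mh) (_ : R₀ ≤ R)
      (D : Domains (PV 2 ℓ m K hd3 hL)) (_ : D.k = K - n) (_ : Adm22 D R ((ℓ + 1) * Mh))
      (w : ℕ → PBond (PV 2 ℓ m K hd3 hL) 0 → ℝ) (_ : IsLevWeight (⟨ℓ + 1, hL, m, hm⟩ : T3Family) n K D w),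
      ∃ ks : Site (PV 2 ℓ m K hd3 hL) 0 → BondIdx D → ℝ,
        (∀ x c, 0 ≤ ks x c) ∧
        (∀ (c : BondIdx D) (b : PBond (PV 2 ℓ m K hd3 hL) 0), |flatH (⟨ℓ + 1, hL, m, hm⟩ : T3Family) n K D (Pi.single c 1) b| ≤ ks b.src c) ∧
        (∀ (c : BondIdx D) (s : SiteIdx D) (x x' : Site (PV 2 ℓ m K hd3 hL) 0), iterBlockOf (s.1.1 : ℕ) x = s.1.2 → iterBlockOf (s.1.1 : ℕ) x' = s.1.2 →
          ks x c = ks x' c) ∧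
        ∀ c : BondIdx D, ∑ b : PBond (PV 2 ℓ m K hd3 hL) 0, (w 3 b)⁻¹ * ks b.src c ≤
          K₀ * (((((ℓ + 1 : ℕ) : ℝ))⁻¹) ^ (K - n))⁻¹ ^ 3 := by
  obtain ⟨Mh₀, R₀, K₀, hK₀, hmain⟩ := FlatPortColumnLetterL0.columnInputs_of_adm22 ℓ hL hℓ
  have hL2 : 2 ≤ ℓ + 1 := by omega
  set Nmax : ℝ := ((((ℓ + 1) ^ (Mh₀ + 2)) ^ 3 : ℕ) : ℝ) with hNmax
  have hN1 : 1 ≤ Nmax := by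
    rw [hNmax]; exact_mod_cast Nat.one_le_pow _ _ (pow_pos (by omega) _)
  refine ⟨(ℓ + 1) ^ Mh₀, R₀, K₀ * Nmax, by positivity, ?_⟩
  intro m hm n K hk1 hk' Mh R a' hMha hMh hR D hDk hAdm w hw
  set E : ℝ := (((((ℓ + 1 : ℕ) : ℝ))⁻¹) ^ (K - n))⁻¹ ^ 3 with hE
  have hE0 : 0 ≤ E := by positivity
  -- the `a′`-reduction to `a₀ := Mh₀`
  have ha : Mh₀ ≤ a' := le_of_pow_le_pow hL2 (by rw [← hMha]; exact hMh)
  have hMh₀ : Mh₀ ≤ (ℓ + 1) ^ Mh₀ := (Nat.lt_pow_self (by omega)).le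
  have hR' : R₀ ≤ R * (ℓ + 1) ^ (a' - Mh₀) := hR.trans (Nat.le_mul_of_pos_right _ (pow_pos (by omega) _))
  rw [hMha] at hAdm
  have hAdm' : Adm22 D (R * (ℓ + 1) ^ (a' - Mh₀)) ((ℓ + 1) * (ℓ + 1) ^ Mh₀) := adm22_reduce D ha hAdm
  by_cases hsz : Mh₀ + 3 ≤ m + n
  · -- above the floor: the port's majorant, column bound weakened by `Nmax ≥ 1`
    obtain ⟨ks, h0, hK, hblk, hcol⟩ := hmain m hm n K hk1 hk' rfl hMh₀ hR' hsz D hDk hAdm' w hw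
    refine ⟨ks, h0, hK, hblk, fun c => (hcol c).trans ?_⟩
    have : K₀ * E ≤ K₀ * Nmax * E := by nlinarith [mul_nonneg hK₀ hE0]
    exact this
  · -- below the floor: the descended majorant on the `L^{jc}`-fold cover
    set jc : ℕ := Mh₀ + 3 - (m + n) with hjc
    have hsz' : Mh₀ + 3 ≤ (m + jc) + n := by omega
    have hjc2 : jc ≤ Mh₀ + 2 := by omega
    obtain ⟨kst, hks0, hKt, hblkt, hcolt⟩ := hmain (m + jc) (by omega) n K hk1 (by omega) rfl hMh₀ hR' hsz' (D.comap jc) hDk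
      (adm22_comap D jc ⟨Mh₀ + 1, by ring⟩ hAdm') (fun i bt => w i (projBond (PV 2 ℓ m K hd3 hL) jc 0 bt))
      (isLevWeight_comap (⟨ℓ + 1, hL, m, hm⟩ : T3Family) n K jc D hw)
    obtain ⟨ks, h0, hK, hblk, hcol⟩ := columnInputs_of_cover (⟨ℓ + 1, hL, m, hm⟩ : T3Family) n K jc D hw
      (flatH (((⟨ℓ + 1, hL, m, hm⟩ : T3Family)).cover jc) n K (D.comap jc))
      (fun X bt => CoverFlatH.flatH_cover (⟨ℓ + 1, hL, m, hm⟩ : T3Family) n K jc D X bt) kst hks0 hKt hblkt hcolt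
    refine ⟨ks, h0, hK, hblk, fun c => (hcol c).trans ?_⟩
    -- the deck factor `(L^{jc})³ ≤ (L^{Mh₀+2})³`
    have hN : (((((ℓ + 1) ^ jc) ^ 3 : ℕ)) : ℝ) ≤ Nmax := by
      rw [hNmax]; exact_mod_cast Nat.pow_le_pow_left (Nat.pow_le_pow_right (by omega) hjc2) 3
    have h1 : K₀ * (((((ℓ + 1) ^ jc) ^ 3 : ℕ)) : ℝ) * E ≤ K₀ * Nmax * E :=
      mul_le_mul_of_nonneg_right (mul_le_mul_of_nonneg_left hN hK₀) hE0
    exact h1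

end AllSizes

end Summit.QuantumFields.YangMills.Theorems.FlatPortAllSizesCol

end
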